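import Literature.Analysis.UnboundedOperators.SemigroupLaplaceResolvent
import Literature.Analysis.UnboundedOperators.StrongContRepresentationDensityProofs
import Literature.Analysis.Convolution.HalfLineConvolution
import Mathlib.Analysis.SpecialFunctions.ImproperIntegrals
import HarnessLib

/-!
# Rank-one feedback around a C₀-semigroup: the mild solution IS a scalar renewal equation, and scalar decay gives vector decay

Topic `Literature/Analysis/UnboundedOperators` (next to `SemigroupLaplaceResolvent*.lean`, `LinearMildFlow*.lean`). Everything PROVED.

SETTING. `S` a C₀-semigroup on a complex Banach space `X` with `‖S(t)‖ ≤ e^{−μt}`, `ℓ : X →L[ℂ] ℂ`, `f ∈ X` (the rank-one feedback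
`u ↦ ℓ(u)·f` — Desch–Schappacher / Engel–Nagel III.1: bounded perturbations), and a continuous MILD SOLUTION of `u′ = Au + ℓ(u) f`:
`u(t) = S(t)u₀ + ∫₀ᵗ S(t − s)(ℓ(u(s))·f) ds` (`t ≥ 0`; variation-of-parameters formula, Engel–Nagel III Cor. 1.7 (IE)).

* `renewal_of_mild` — applying `ℓ`: the amplitude `m = ℓ ∘ u` solves the SCALAR RENEWAL EQUATION `m = m₀ + k ⋆ m` on `[0,∞)` with
  `k(t) = ℓ(S(t)f)`, `m₀(t) = ℓ(S(t)u₀)` (`⋆` = `hconv` of `HalfLineConvolution.lean`); bound `‖ℓ(S(t)x)‖ ≤ ‖ℓ‖‖x‖e^{−μt}`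
  (the tree's `RankOneDuhamelRenewal.renewal_equation` is the same statement for the PAIR of semigroups `S_F`, `S` whose generators differ
  by `ℓ(·)f`; here `u` is any continuous mild solution, e.g. `u = S_F(·)x` by `app_eq_add_integral_rankOne`);
* `mild_eq_smul` — conversely `u(t) = S(t)u₀ + ∫₀ᵗ m(s)·S(t − s)f ds`: the flow is the free flow plus the amplitude fed through `S(·)f`;
* `norm_mild_sub_mode_le` — **SCALAR DECAY ⇒ VECTOR DECAY**: if `‖m(s) − c₁e^{s}‖ ≤ M e^{−β′s}` on `s ≥ 0` with `0 < β′ < μ`, then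
  `‖u(t) − c₁e^{t}·R(1)f‖ ≤ (‖u₀‖ + M‖f‖/(μ − β′) + ‖c₁‖‖f‖/(1 + μ))·e^{−β′t}`, where `R(1)f = ∫₀^∞ e^{−σ}S(σ)f dσ`
  (`C0Semigroup.laplaceResolventFun S 1 f`) — the growing mode's DIRECTION is the resolvent vector `R(1)f`.

USE (cell ns-blowup, Z3-SR-SPEC «linearly stable modulo gauge», memo P9-P10-RENEWAL-DESIGN v2, bricks (R-a)/(R-e)): with the scalar renewal
theorem (`Summit….SheetRRenewalScalar.norm_renewal_sub_mode_le`: `c₁ = E′(1)⁻¹∫₀^∞e^{−s}m₀`) every mild solution of the linearised sheet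
flow is `c(u₀)e^{t}·(gauge mode) + O(e^{−β′t})`. NOT here: existence/uniqueness of mild solutions, the sheet, any model.

## References
* K.-J. Engel, R. Nagel, *One-Parameter Semigroups for Linear Evolution Equations*, Springer GTM 194 (2000), Ch. III Cor. 1.7, Ch. II (1.13). [EngelNagel2000]
-/

noncomputable section

open _root_.MeasureTheory _root_.Set _root_.Filter _root_.Real _root_.Complex intervalIntegral NNReal
open scoped _root_.Topology
open Literature.Analysis.Convolution

namespace Literature.Analysis.UnboundedOperators

namespace C0Semigroup

variable {X : Type*} [NormedAddCommGroup X] [NormedSpace ℂ X]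
variable (S : C0Semigroup ℂ X) (ℓ : X →L[ℂ] ℂ) (f u₀ : X)

/-! ### The orbit maps in the real time variable -/

/-- Orbit bound `‖S(t⁺)x‖ ≤ e^{−μt}‖x‖` for `t ≥ 0` under `‖S(t)‖ ≤ e^{−μt}`. [cite: EngelNagel2000, Ch. I Def. 5.6 / Prop. 5.5] -/
theorem norm_app_toNNReal_le {μ : ℝ} (hS : ∀ t : ℝ≥0, ‖S.app t‖ ≤ Real.exp (-μ * t)) (x : X) {t : ℝ} (ht : 0 ≤ t) :
    ‖S.app (Real.toNNReal t) x‖ ≤ Real.exp (-μ * t) * ‖x‖ := by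
  refine (ContinuousLinearMap.le_opNorm _ _).trans (mul_le_mul_of_nonneg_right ?_ (norm_nonneg _))
  simpa [Real.coe_toNNReal t ht] using hS (Real.toNNReal t)

/-! ### (R-a) the mild solution is a scalar renewal equation -/

section Renewal

variable {S ℓ f u₀}
variable {u : ℝ → X}

/-- The Duhamel integrand `s ↦ S(t − s)(ℓ(u(s))·f)` is continuous for continuous `u`. [cite: EngelNagel2000, Ch. III Cor. 1.7 (IE)] -/
theorem continuous_mild_integrand (hu : Continuous u) (t : ℝ) :
    Continuous fun s : ℝ => S.app (Real.toNNReal (t - s)) (ℓ (u s) • f) := by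
  have h1 : Continuous fun s : ℝ => S.app (Real.toNNReal (t - s)) f :=
    (S.continuous_app f).comp (continuous_real_toNNReal.comp (continuous_const.sub continuous_id))
  have h2 : Continuous fun s : ℝ => ℓ (u s) := ℓ.continuous.comp hu
  simp_rw [ContinuousLinearMap.map_smul]
  exact h2.smul h1

/-- **The amplitude solves the renewal equation.** If `u` is a continuous mild solution,
`u(t) = S(t)u₀ + ∫₀ᵗ S(t−s)(ℓ(u(s))·f) ds` on `t ≥ 0`, then `m = ℓ ∘ u` satisfies `m(t) = ℓ(S(t)u₀) + (k ⋆ m)(t)` on `t ≥ 0`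
with `k(t) = ℓ(S(t)f)`. [cite: EngelNagel2000, Ch. III Cor. 1.7 (IE)] -/
theorem renewal_of_mild [CompleteSpace X] (hu : Continuous u)
    (hmild : ∀ t : ℝ, 0 ≤ t → u t = S.app (Real.toNNReal t) u₀ + ∫ s in (0 : ℝ)..t, S.app (Real.toNNReal (t - s)) (ℓ (u s) • f))
    {t : ℝ} (ht : 0 ≤ t) :
    ℓ (u t) = ℓ (S.app (Real.toNNReal t) u₀) +
      hconv (fun s : ℝ => ℓ (S.app (Real.toNNReal s) f)) (fun s : ℝ => ℓ (u s)) t := by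
  rw [hmild t ht, map_add, hconv]
  congr 1
  rw [← ℓ.intervalIntegral_comp_comm ((continuous_mild_integrand hu t).intervalIntegrable 0 t)]
  refine intervalIntegral.integral_congr fun s _ => ?_
  simp only [ContinuousLinearMap.map_smul, smul_eq_mul]
  ring

/-- The renewal kernel `k(t) = ℓ(S(t⁺)x)` obeys `‖k(t)‖ ≤ ‖ℓ‖‖x‖e^{−μt}` on `t ≥ 0`.
[cite: EngelNagel2000, Ch. I Prop. 5.5] -/
theorem norm_apply_app_toNNReal_le {μ : ℝ} (hS : ∀ t : ℝ≥0, ‖S.app t‖ ≤ Real.exp (-μ * t)) (x : X) {t : ℝ} (ht : 0 ≤ t) :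
    ‖ℓ (S.app (Real.toNNReal t) x)‖ ≤ ‖ℓ‖ * ‖x‖ * Real.exp (-μ * t) := by
  refine (ℓ.le_opNorm _).trans ?_
  rw [mul_assoc]
  refine mul_le_mul_of_nonneg_left ?_ (norm_nonneg _)
  rw [mul_comm]
  exact S.norm_app_toNNReal_le hS x ht

/-- **The flow through the amplitude**: `u(t) = S(t)u₀ + ∫₀ᵗ ℓ(u(s))·S(t−s)f ds`. [cite: EngelNagel2000, Ch. III Cor. 1.7 (IE)] -/
theorem mild_eq_smul
    (hmild : ∀ t : ℝ, 0 ≤ t → u t = S.app (Real.toNNReal t) u₀ + ∫ s in (0 : ℝ)..t, S.app (Real.toNNReal (t - s)) (ℓ (u s) • f))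
    {t : ℝ} (ht : 0 ≤ t) :
    u t = S.app (Real.toNNReal t) u₀ + ∫ s in (0 : ℝ)..t, ℓ (u s) • S.app (Real.toNNReal (t - s)) f := by
  rw [hmild t ht]
  simp_rw [ContinuousLinearMap.map_smul]

end Renewal

/-! ### (R-e) scalar decay gives vector decay -/

section Decay

variable {S ℓ f u₀}
variable {u : ℝ → X}

/-- The tail of the resolvent integral at `1`: `‖∫_{(t,∞)} e^{−σ}S(σ)f dσ‖ ≤ ‖f‖e^{−(1+μ)t}/(1+μ)` (`t ≥ 0`, `μ > −1`).
[cite: EngelNagel2000, Ch. II Thm. 1.10 (1.14)] -/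
theorem norm_integral_Ioi_resolvent_le {μ : ℝ} (hS : ∀ t : ℝ≥0, ‖S.app t‖ ≤ Real.exp (-μ * t)) (hμ : 0 < 1 + μ)
    {t : ℝ} (ht : 0 ≤ t) :
    ‖∫ σ in Ioi t, cexp (-((1 : ℂ) * σ)) • S.app (Real.toNNReal σ) f‖ ≤ ‖f‖ * Real.exp (-(1 + μ) * t) / (1 + μ) := by
  have hle : ∀ σ ∈ Ioi t, ‖cexp (-((1 : ℂ) * σ)) • S.app (Real.toNNReal σ) f‖ ≤ ‖f‖ * Real.exp (-(1 + μ) * σ) := by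
    intro σ hσ
    have hσ0 : 0 ≤ σ := ht.trans (le_of_lt hσ)
    rw [norm_smul, Complex.norm_exp]
    simp only [one_mul, neg_re, ofReal_re]
    calc Real.exp (-σ) * ‖S.app (Real.toNNReal σ) f‖ ≤ Real.exp (-σ) * (Real.exp (-μ * σ) * ‖f‖) :=
          mul_le_mul_of_nonneg_left (S.norm_app_toNNReal_le hS f hσ0) (Real.exp_pos _).le
      _ = ‖f‖ * Real.exp (-(1 + μ) * σ) := by
          rw [show -(1 + μ) * σ = -σ + -μ * σ by ring, Real.exp_add]; ring
  have hdom : IntegrableOn (fun σ : ℝ => ‖f‖ * Real.exp (-(1 + μ) * σ)) (Ioi t) :=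
    (integrableOn_exp_mul_Ioi (by linarith) t).const_mul _
  have hint : IntegrableOn (fun σ : ℝ => cexp (-((1 : ℂ) * σ)) • S.app (Real.toNNReal σ) f) (Ioi t) :=
    Integrable.mono' hdom ((S.continuous_integrand 1 f).aestronglyMeasurable)
      ((ae_restrict_iff' measurableSet_Ioi).2 (Eventually.of_forall hle))
  calc ‖∫ σ in Ioi t, cexp (-((1 : ℂ) * σ)) • S.app (Real.toNNReal σ) f‖
      ≤ ∫ σ in Ioi t, ‖cexp (-((1 : ℂ) * σ)) • S.app (Real.toNNReal σ) f‖ := norm_integral_le_integral_norm _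
    _ ≤ ∫ σ in Ioi t, ‖f‖ * Real.exp (-(1 + μ) * σ) := setIntegral_mono_on hint.norm hdom measurableSet_Ioi hle
    _ = ‖f‖ * Real.exp (-(1 + μ) * t) / (1 + μ) := by
        rw [MeasureTheory.integral_const_mul, integral_exp_mul_Ioi (by linarith) t]; field_simp

/-- The Duhamel integral of the growing exponential: `∫₀ᵗ e^{s}·S(t−s)f ds = e^{t}·(R(1)f − ∫_{(t,∞)} e^{−σ}S(σ)f dσ)`.
[cite: EngelNagel2000, Ch. II Thm. 1.10 (1.13)] -/
theorem integral_exp_smul_app_eq {μ : ℝ} (hS : ∀ t : ℝ≥0, ‖S.app t‖ ≤ Real.exp (-μ * t)) (hμ : 0 < 1 + μ) {t : ℝ} (ht : 0 ≤ t) :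
    ∫ s in (0 : ℝ)..t, cexp s • S.app (Real.toNNReal (t - s)) f =
      cexp t • (S.laplaceResolventFun 1 f - ∫ σ in Ioi t, cexp (-((1 : ℂ) * σ)) • S.app (Real.toNNReal σ) f) := by
  -- substitution `σ = t − s`
  have hsub := intervalIntegral.integral_comp_sub_left
    (fun σ : ℝ => cexp ((t - σ : ℝ) : ℂ) • S.app (Real.toNNReal σ) f) t (a := 0) (b := t)
  simp only [sub_sub_cancel, sub_self, sub_zero] at hsub
  have h1 : (∫ s in (0 : ℝ)..t, cexp s • S.app (Real.toNNReal (t - s)) f) =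
      ∫ σ in (0 : ℝ)..t, cexp ((t - σ : ℝ) : ℂ) • S.app (Real.toNNReal σ) f := by
    rw [← hsub]
  rw [h1]
  have h2 : ∀ σ : ℝ, cexp ((t - σ : ℝ) : ℂ) • S.app (Real.toNNReal σ) f =
      cexp t • (cexp (-((1 : ℂ) * σ)) • S.app (Real.toNNReal σ) f) := by
    intro σ
    rw [smul_smul, ← Complex.exp_add]
    congr 1; push_cast; ring_nf
  simp_rw [h2]
  rw [intervalIntegral.integral_smul]
  congr 1
  have hM : ∀ s : ℝ≥0, ‖S.app s‖ ≤ 1 * Real.exp (-μ * s) := fun s => by simpa using hS s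
  have hint : IntegrableOn (fun σ : ℝ => cexp (-((1 : ℂ) * σ)) • S.app (Real.toNNReal σ) f) (Ioi 0) :=
    S.integrableOn_integrand hM (by simp; linarith) f
  rw [laplaceResolventFun, eq_sub_iff_add_eq]
  exact intervalIntegral.integral_interval_add_Ioi hint (hint.mono_set (Ioi_subset_Ioi ht))

/-- `∫₀ᵗ e^{−β′s}e^{−μ(t−s)} ds ≤ e^{−β′t}/(μ − β′)` for `β′ < μ`. [folklore] -/
private theorem integral_exp_exp_le {μ β' t : ℝ} (hβ : β' < μ) :
    ∫ s in (0 : ℝ)..t, Real.exp (-β' * s) * Real.exp (-μ * (t - s)) ≤ Real.exp (-β' * t) / (μ - β') := by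
  have hc : 0 < μ - β' := sub_pos.2 hβ
  have hpt : ∀ s : ℝ, Real.exp (-β' * s) * Real.exp (-μ * (t - s)) = Real.exp (-μ * t) * Real.exp ((μ - β') * s) := by
    intro s; rw [← Real.exp_add, ← Real.exp_add]; ring_nf
  simp_rw [hpt]
  rw [intervalIntegral.integral_const_mul]
  have hderiv : ∀ s ∈ uIcc 0 t, HasDerivAt (fun s : ℝ => Real.exp ((μ - β') * s) / (μ - β')) (Real.exp ((μ - β') * s)) s := by
    intro s _
    have h1 : HasDerivAt (fun s : ℝ => (μ - β') * s) (μ - β') s := by simpa using (hasDerivAt_id s).const_mul (μ - β')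
    exact (h1.exp.div_const (μ - β')).congr_deriv (by field_simp)
  rw [intervalIntegral.integral_eq_sub_of_hasDerivAt hderiv ((Continuous.continuousOn (by fun_prop)).intervalIntegrable),
    mul_zero, Real.exp_zero]
  have h3 : Real.exp (-μ * t) * (Real.exp ((μ - β') * t) / (μ - β') - 1 / (μ - β')) =
      (Real.exp (-β' * t) - Real.exp (-μ * t)) / (μ - β') := by
    have he : Real.exp (-μ * t) * Real.exp ((μ - β') * t) = Real.exp (-β' * t) := by
      rw [← Real.exp_add]; ring_nf
    rw [mul_sub, ← mul_div_assoc, he, mul_one_div, div_sub_div_same]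
  rw [h3]
  exact div_le_div_of_nonneg_right (by linarith [Real.exp_pos (-μ * t)]) hc.le

/-- **SCALAR DECAY ⇒ VECTOR DECAY.** Let `‖S(t)‖ ≤ e^{−μt}` (`μ > 0`), let `u` be a continuous mild solution of the rank-one feedback
problem, and suppose its amplitude splits as `‖ℓ(u(s)) − c₁e^{s}‖ ≤ M e^{−β′s}` on `s ≥ 0` with `0 < β′ < μ`. Then for `t ≥ 0`
`‖u(t) − c₁e^{t}·R(1)f‖ ≤ (‖u₀‖ + M‖f‖/(μ − β′) + ‖c₁‖‖f‖/(1 + μ))·e^{−β′t}`. [cite: EngelNagel2000, Ch. III Cor. 1.7 / Ch. II (1.13)] -/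
theorem norm_mild_sub_mode_le {μ β' M : ℝ} {c₁ : ℂ} (hS : ∀ t : ℝ≥0, ‖S.app t‖ ≤ Real.exp (-μ * t)) (hμ : 0 < μ)
    (hu : Continuous u)
    (hmild : ∀ t : ℝ, 0 ≤ t → u t = S.app (Real.toNNReal t) u₀ + ∫ s in (0 : ℝ)..t, S.app (Real.toNNReal (t - s)) (ℓ (u s) • f))
    (hβ' : 0 < β') (hβ'μ : β' < μ) (hm : ∀ s : ℝ, 0 ≤ s → ‖ℓ (u s) - c₁ * cexp s‖ ≤ M * Real.exp (-β' * s))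
    {t : ℝ} (ht : 0 ≤ t) :
    ‖u t - (c₁ * cexp t) • S.laplaceResolventFun 1 f‖ ≤
      (‖u₀‖ + M * ‖f‖ / (μ - β') + ‖c₁‖ * ‖f‖ / (1 + μ)) * Real.exp (-β' * t) := by
  have hμ1 : 0 < 1 + μ := by linarith
  have hM0 : 0 ≤ M := by simpa using (norm_nonneg _).trans (hm 0 le_rfl)
  -- continuity / integrability of the pieces
  have hSf : Continuous fun s : ℝ => S.app (Real.toNNReal (t - s)) f :=
    (S.continuous_app f).comp (continuous_real_toNNReal.comp (continuous_const.sub continuous_id))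
  have hm_c : Continuous fun s : ℝ => ℓ (u s) := ℓ.continuous.comp hu
  have hi1 : IntervalIntegrable (fun s : ℝ => (ℓ (u s) - c₁ * cexp s) • S.app (Real.toNNReal (t - s)) f) volume 0 t :=
    ((hm_c.sub (by fun_prop)).smul hSf).intervalIntegrable 0 t
  have hi2 : IntervalIntegrable (fun s : ℝ => (c₁ * cexp s) • S.app (Real.toNNReal (t - s)) f) volume 0 t :=
    ((Continuous.smul (by fun_prop) hSf)).intervalIntegrable 0 t
  -- the decomposition of the Duhamel term
  have hsplit : (∫ s in (0 : ℝ)..t, ℓ (u s) • S.app (Real.toNNReal (t - s)) f) =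
      (∫ s in (0 : ℝ)..t, (ℓ (u s) - c₁ * cexp s) • S.app (Real.toNNReal (t - s)) f) +
        c₁ • ∫ s in (0 : ℝ)..t, cexp s • S.app (Real.toNNReal (t - s)) f := by
    rw [← intervalIntegral.integral_smul, ← intervalIntegral.integral_add hi1 (by
      simpa [smul_smul] using hi2)]
    refine intervalIntegral.integral_congr fun s _ => ?_
    simp only [smul_smul, ← add_smul, sub_add_cancel]
  set tail : X := ∫ σ in Ioi t, cexp (-((1 : ℂ) * σ)) • S.app (Real.toNNReal σ) f with htail
  have hkey : u t - (c₁ * cexp t) • S.laplaceResolventFun 1 f =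
      S.app (Real.toNNReal t) u₀ + (∫ s in (0 : ℝ)..t, (ℓ (u s) - c₁ * cexp s) • S.app (Real.toNNReal (t - s)) f) -
        (c₁ * cexp t) • tail := by
    rw [S.mild_eq_smul hmild ht, hsplit, S.integral_exp_smul_app_eq hS hμ1 ht, smul_sub, smul_sub, smul_smul, smul_smul]
    abel
  rw [hkey]
  -- three bounds
  have hb1 : ‖S.app (Real.toNNReal t) u₀‖ ≤ ‖u₀‖ * Real.exp (-β' * t) := by
    refine (S.norm_app_toNNReal_le hS u₀ ht).trans ?_
    rw [mul_comm]
    exact mul_le_mul_of_nonneg_left (Real.exp_le_exp.2 (by nlinarith)) (norm_nonneg _)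
  have hb2 : ‖∫ s in (0 : ℝ)..t, (ℓ (u s) - c₁ * cexp s) • S.app (Real.toNNReal (t - s)) f‖ ≤
      M * ‖f‖ / (μ - β') * Real.exp (-β' * t) := by
    have hle : ∀ s ∈ Set.Ioc (0 : ℝ) t, ‖(ℓ (u s) - c₁ * cexp s) • S.app (Real.toNNReal (t - s)) f‖ ≤
        M * ‖f‖ * (Real.exp (-β' * s) * Real.exp (-μ * (t - s))) := by
      intro s hs
      rw [norm_smul]
      calc ‖ℓ (u s) - c₁ * cexp s‖ * ‖S.app (Real.toNNReal (t - s)) f‖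
          ≤ (M * Real.exp (-β' * s)) * (Real.exp (-μ * (t - s)) * ‖f‖) :=
            mul_le_mul (hm s hs.1.le) (S.norm_app_toNNReal_le hS f (by linarith [hs.2])) (norm_nonneg _) (by positivity)
        _ = M * ‖f‖ * (Real.exp (-β' * s) * Real.exp (-μ * (t - s))) := by ring
    refine (intervalIntegral.norm_integral_le_of_norm_le ht (Eventually.of_forall hle)
      ((Continuous.continuousOn (by fun_prop)).intervalIntegrable)).trans ?_
    rw [intervalIntegral.integral_const_mul]
    calc M * ‖f‖ * ∫ s in (0 : ℝ)..t, Real.exp (-β' * s) * Real.exp (-μ * (t - s))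
        ≤ M * ‖f‖ * (Real.exp (-β' * t) / (μ - β')) :=
          mul_le_mul_of_nonneg_left (integral_exp_exp_le hβ'μ) (by positivity)
      _ = M * ‖f‖ / (μ - β') * Real.exp (-β' * t) := by ring
  have hb3 : ‖(c₁ * cexp t) • tail‖ ≤ ‖c₁‖ * ‖f‖ / (1 + μ) * Real.exp (-β' * t) := by
    rw [norm_smul, norm_mul, Complex.norm_exp, ofReal_re]
    have htl := S.norm_integral_Ioi_resolvent_le (f := f) hS hμ1 ht
    calc ‖c₁‖ * Real.exp t * ‖tail‖ ≤ ‖c₁‖ * Real.exp t * (‖f‖ * Real.exp (-(1 + μ) * t) / (1 + μ)) :=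
          mul_le_mul_of_nonneg_left htl (by positivity)
      _ = ‖c₁‖ * ‖f‖ / (1 + μ) * (Real.exp t * Real.exp (-(1 + μ) * t)) := by ring
      _ = ‖c₁‖ * ‖f‖ / (1 + μ) * Real.exp (-μ * t) := by rw [← Real.exp_add]; ring_nf
      _ ≤ ‖c₁‖ * ‖f‖ / (1 + μ) * Real.exp (-β' * t) :=
          mul_le_mul_of_nonneg_left (Real.exp_le_exp.2 (by nlinarith)) (by positivity)
  calc ‖S.app (Real.toNNReal t) u₀ + (∫ s in (0 : ℝ)..t, (ℓ (u s) - c₁ * cexp s) • S.app (Real.toNNReal (t - s)) f) -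
        (c₁ * cexp t) • tail‖
      ≤ ‖S.app (Real.toNNReal t) u₀‖ + ‖∫ s in (0 : ℝ)..t, (ℓ (u s) - c₁ * cexp s) • S.app (Real.toNNReal (t - s)) f‖ +
        ‖(c₁ * cexp t) • tail‖ := by
          refine (norm_sub_le _ _).trans (add_le_add (norm_add_le _ _) le_rfl)
    _ ≤ _ := by rw [add_mul, add_mul]; exact add_le_add (add_le_add hb1 hb2) hb3

end Decay

end C0Semigroup

end Literature.Analysis.UnboundedOperators
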